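import Summits.BirchSwinnertonDyer.BirchSwinnertonDyer.Theorems.ResidualThetaTransportAtTwoThetaLayerLambdaCongruenceAtTwoHeckeAdjointManinSum
import Summits.BirchSwinnertonDyer.BirchSwinnertonDyer.Theorems.ResidualThetaTransportAtTwoThetaLayerLambdaCongruenceAtTwoHeckeAdjointDualSide
import Summits.BirchSwinnertonDyer.BirchSwinnertonDyer.Theorems.ResidualThetaTransportAtTwoThetaLayerLambdaCongruenceAtTwoHeckeAdjointHeckeCocycleTranspose
import Summits.BirchSwinnertonDyer.BirchSwinnertonDyer.Theorems.ResidualThetaTransportAtTwoThetaLayerLambdaCongruenceAtTwoHeckeAdjointSweepTransposed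
import Summits.BirchSwinnertonDyer.BirchSwinnertonDyer.Theorems.ResidualThetaTransportAtTwoThetaLayerLambdaCongruenceAtTwoHeckeAdjointTransposeSplit
import Summits.BirchSwinnertonDyer.BirchSwinnertonDyer.Theorems.ResidualThetaTransportAtTwoThetaLayerLambdaCongruenceAtTwoManinChain
import HarnessLib

/-!
# Crux Kan⁺ `ThetaLayerLambdaCongruenceAtTwo` (stmt-BirchSwinnertonDyer-20688), line `birth` v14, SD floor — Hecke clause of IP,
# brick HA8 (the glue): FLIPPED TRANSPOSE-ADJOINTNESS OF THE CROSSING PAIRING, and IP BY NAME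
# (width seat bsd-wall-rtt-p3-w3 g11; `--supports stmt-BirchSwinnertonDyer-20688`; THEOREMS ONLY — no `def`, no named-fact hypothesis, no `sorry`)

HONEST FRAMING. This file assembles the team's kernel bricks (plan `Cruxes/ThetaLayerLambdaCongruenceAtTwo/Lines/birth-sd2-hecke-adjoint.md`)
into the hypothesis `hHA` of `ip_of_crossingPairing_flippedTransposeAdjoint` (rtt-p3-w4 g7 / lead g13): for every pairing `B` on
`Λ = periodHomologyHecke N` satisfying rtt-p3-w2 g8's crossing formula, every prime `p`, and `x, y, x' ∈ Λ` with `x' = T♯_p^∨ x`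
(`T♯_p = [Γ₀(N) diag(p,1) Γ₀(N)]`), `B(x', y) = B(x, T_p • y)`.  Consequently (`ip_of_crossingPairing_flippedTransposeAdjoint`, whose
crossing pairing is w2's perfect one) the named input IP `periodHomology_exists_heckeSelfAdjoint_perfectPairing` holds.  Nothing here
settles Kan⁺ (the cosocle / multiplicity-one clause is untouched); BSD is not proved by any of this.

PROOF (per `γ, γ'`, `x = {∞,γ∞}`, `y = {∞,γ'∞}`, both sides doubled):
* dual slot: `x' = Σ_i {∞, ε_i∞}` for w4's transposed cocycle `M̃_i γ = ε_i M̃_{σ i}` (`exists_transposeHeckeCocycle_fin/_option`), and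
  `2·Σ_i B({∞,ε_i∞}, y) = Σ_{g∈L} Σ_i Σᶠ_u [F(g⁻¹u⁻¹M̃_iγ) − F(g⁻¹u⁻¹M̃_i)]` (`dual_side_flag_sum`, bricks HA1–HA3);
* Manin slot: `T_p • y = Σ_i {∞, δ_i∞}` for the cocycle `M_i γ' = δ_i M_{σ i}` (`exists_heckeCocycle_fin/_option`,
  `heckeT_smul_periodFunctional_eq_sum_cocycle_*`), and `2·Σ_i B(x, {∞,δ_i∞}) = Σ_{g∈L} Σ_i Σᶠ_u [F(g⁻¹adj(M_i)u⁻¹γ) − F(g⁻¹adj(M_i)u⁻¹)]`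
  (`manin_side_flag_sum`, bricks HA4–HA7);
* the two inner double sums agree for each `g` by the transposed sweep `sum_finsum_adj_tpB_mul_inv_eq` / `sum_finsum_adj_rep_mul_inv_eq`
  (lead g13), whose finiteness inputs are `finite_support_manin_summand` and `finite_support_dual_summand` (below).
Here `F` is the symbolic flag side of brick HA2 (inline `if`-spelling, as in all HA files) and `L` a Manin chain of `γ'`.

References: L. Merel, Homologie des courbes modulaires affines et paramétrisations modulaires (1995), §1.2–1.3, §2.1–2.3 [Merel1995Homologie];
Ju. I. Manin, Parabolic points and zeta functions of modular curves (1972), Thm. 1.9 [Manin1972]; F. Diamond, J. Shurman, A First Course in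
Modular Forms (2005), §5.2 [DiamondShurman2005]; J. E. Cremona, Algorithms for modular elliptic curves (1997), §2.1, §2.4 [CremonaAlgorithms1997].
-/

set_option autoImplicit false

noncomputable section

-- justification: the `Summit.BirchSwinnertonDyer.BirchSwinnertonDyer.…` path repeats a component (route-file convention)
set_option linter.dupNamespace false

open scoped Classical MatrixGroups

open CongruenceSubgroup Matrix.SpecialLinearGroup ModularGroup
open Literature.NumberTheory.EllipticCurves.ModularForms

namespace Summit.BirchSwinnertonDyer.BirchSwinnertonDyer.Theorems.ThetaLayerLambdaCongruenceAtTwo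

section DualSupport

variable {N : ℕ}

/-- **Finite support of the dual-side summand**: for an integer matrix `M` of positive determinant, `g ∈ SL₂(ℤ)` and `γ ∈ Γ₀(N)`, only finitely
many `u ∈ Γ₀(N)` contribute to `F(g⁻¹·u⁻¹·M·γ) − F(g⁻¹·u⁻¹·M)`: through the flag anchors `m₁, m₂` of `M`, `Mγ` (`exists_flagAnchor`) the summand is
the net crossing of `Γ₀(N)·g` by a dual-graph walk from `m₁` to `m₂` (`finite_support_sideDiff`). [cite: Merel1995Homologie, §2.1] -/
theorem finite_support_dual_summand (γ : Gamma0 N) (M : Matrix (Fin 2) (Fin 2) ℤ) (hM : 0 < M.det) (g : SL(2, ℤ)) :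
    (Function.support fun u : Gamma0 N ↦
        ((if (0 < (((g⁻¹ : SL(2, ℤ)) : Matrix (Fin 2) (Fin 2) ℤ) * (((u⁻¹ : Gamma0 N) : SL(2, ℤ)) : Matrix (Fin 2) (Fin 2) ℤ) * M * ((γ : SL(2, ℤ)) : Matrix (Fin 2) (Fin 2) ℤ)) 0 0 * (((g⁻¹ : SL(2, ℤ)) : Matrix (Fin 2) (Fin 2) ℤ) * (((u⁻¹ : Gamma0 N) : SL(2, ℤ)) : Matrix (Fin 2) (Fin 2) ℤ) * M * ((γ : SL(2, ℤ)) : Matrix (Fin 2) (Fin 2) ℤ)) 1 0 ∨ ((((g⁻¹ : SL(2, ℤ)) : Matrix (Fin 2) (Fin 2) ℤ) * (((u⁻¹ : Gamma0 N) : SL(2, ℤ)) : Matrix (Fin 2) (Fin 2) ℤ) * M * ((γ : SL(2, ℤ)) : Matrix (Fin 2) (Fin 2) ℤ)) 0 0 * (((g⁻¹ : SL(2, ℤ)) : Matrix (Fin 2) (Fin 2) ℤ) * (((u⁻¹ : Gamma0 N) : SL(2, ℤ)) : Matrix (Fin 2) (Fin 2) ℤ) * M * ((γ : SL(2, ℤ))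 : Matrix (Fin 2) (Fin 2) ℤ)) 1 0 = 0 ∧ (0 < ((((g⁻¹ : SL(2, ℤ)) : Matrix (Fin 2) (Fin 2) ℤ) * (((u⁻¹ : Gamma0 N) : SL(2, ℤ)) : Matrix (Fin 2) (Fin 2) ℤ) * M * ((γ : SL(2, ℤ)) : Matrix (Fin 2) (Fin 2) ℤ)) 0 0 + 2 * (((g⁻¹ : SL(2, ℤ)) : Matrix (Fin 2) (Fin 2) ℤ) * (((u⁻¹ : Gamma0 N) : SL(2, ℤ)) : Matrix (Fin 2) (Fin 2) ℤ) * M * ((γ : SL(2, ℤ)) : Matrix (Fin 2) (Fin 2) ℤ)) 0 1) * ((((g⁻¹ : SL(2, ℤ)) : Matrix (Fin 2) (Fin 2) ℤ) * (((u⁻¹ : Gamma0 N) : SL(2, ℤ)) : Matrix (Fin 2) (Fin 2) ℤ) * M * ((γ : SL(2, ℤ)) : Matrix (Fin 2) (Fin 2) ℤ)) 1 0 + 2 * (((g⁻¹ : SL(2, ℤ)) : Matrix (Fin 2) (Fin 2) ℤ) * (((u⁻¹ : Gamma0 N) : SL(2, ℤ)) : Matrix (Fin 2) (Fin 2) ℤ)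 * M * ((γ : SL(2, ℤ)) : Matrix (Fin 2) (Fin 2) ℤ)) 1 1) ∨
          (((((g⁻¹ : SL(2, ℤ)) : Matrix (Fin 2) (Fin 2) ℤ) * (((u⁻¹ : Gamma0 N) : SL(2, ℤ)) : Matrix (Fin 2) (Fin 2) ℤ) * M * ((γ : SL(2, ℤ)) : Matrix (Fin 2) (Fin 2) ℤ)) 0 0 + 2 * (((g⁻¹ : SL(2, ℤ)) : Matrix (Fin 2) (Fin 2) ℤ) * (((u⁻¹ : Gamma0 N) : SL(2, ℤ)) : Matrix (Fin 2) (Fin 2) ℤ) * M * ((γ : SL(2, ℤ)) : Matrix (Fin 2) (Fin 2) ℤ)) 0 1) * ((((g⁻¹ : SL(2, ℤ)) : Matrix (Fin 2) (Fin 2) ℤ) * (((u⁻¹ : Gamma0 N) : SL(2, ℤ)) : Matrix (Fin 2) (Fin 2) ℤ) * M * ((γ : SL(2, ℤ)) : Matrix (Fin 2) (Fin 2) ℤ)) 1 0 + 2 * (((g⁻¹ : SL(2, ℤ)) : Matrix (Fin 2) (Fin 2) ℤ) * (((u⁻¹ : Gamma0 N) : SL(2, ℤ)) : Matrix (Fin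 2) (Fin 2) ℤ) * M * ((γ : SL(2, ℤ)) : Matrix (Fin 2) (Fin 2) ℤ)) 1 1) = 0 ∧ 0 < (((g⁻¹ : SL(2, ℤ)) : Matrix (Fin 2) (Fin 2) ℤ) * (((u⁻¹ : Gamma0 N) : SL(2, ℤ)) : Matrix (Fin 2) (Fin 2) ℤ) * M * ((γ : SL(2, ℤ)) : Matrix (Fin 2) (Fin 2) ℤ)) 0 0 * (((g⁻¹ : SL(2, ℤ)) : Matrix (Fin 2) (Fin 2) ℤ) * (((u⁻¹ : Gamma0 N) : SL(2, ℤ)) : Matrix (Fin 2) (Fin 2) ℤ) * M * ((γ : SL(2, ℤ)) : Matrix (Fin 2) (Fin 2) ℤ)) 1 1 + (((g⁻¹ : SL(2, ℤ)) : Matrix (Fin 2) (Fin 2) ℤ) * (((u⁻¹ : Gamma0 N) : SL(2, ℤ)) : Matrix (Fin 2) (Fin 2) ℤ) * M * ((γ : SL(2, ℤ)) : Matrix (Fin 2) (Fin 2) ℤ)) 0 1 * (((g⁻¹ : SL(2, ℤ)) : Matrix (Fin 2) (Fin 2) ℤ) * (((u⁻¹ : Gamma0 N) : SL(2, ℤ))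 : Matrix (Fin 2) (Fin 2) ℤ) * M * ((γ : SL(2, ℤ)) : Matrix (Fin 2) (Fin 2) ℤ)) 1 0)))) then (1 : ℤ) else 0) -
         (if (0 < (((g⁻¹ : SL(2, ℤ)) : Matrix (Fin 2) (Fin 2) ℤ) * (((u⁻¹ : Gamma0 N) : SL(2, ℤ)) : Matrix (Fin 2) (Fin 2) ℤ) * M) 0 0 * (((g⁻¹ : SL(2, ℤ)) : Matrix (Fin 2) (Fin 2) ℤ) * (((u⁻¹ : Gamma0 N) : SL(2, ℤ)) : Matrix (Fin 2) (Fin 2) ℤ) * M) 1 0 ∨ ((((g⁻¹ : SL(2, ℤ)) : Matrix (Fin 2) (Fin 2) ℤ) * (((u⁻¹ : Gamma0 N) : SL(2, ℤ)) : Matrix (Fin 2) (Fin 2) ℤ) * M) 0 0 * (((g⁻¹ : SL(2, ℤ)) : Matrix (Fin 2) (Fin 2) ℤ) * (((u⁻¹ : Gamma0 N) : SL(2, ℤ)) : Matrix (Fin 2) (Fin 2) ℤ) * M) 1 0 = 0 ∧ (0 < ((((g⁻¹ : SL(2, ℤ)) : Matrix (Fin 2) (Fin 2) ℤ) * (((u⁻¹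 : Gamma0 N) : SL(2, ℤ)) : Matrix (Fin 2) (Fin 2) ℤ) * M) 0 0 + 2 * (((g⁻¹ : SL(2, ℤ)) : Matrix (Fin 2) (Fin 2) ℤ) * (((u⁻¹ : Gamma0 N) : SL(2, ℤ)) : Matrix (Fin 2) (Fin 2) ℤ) * M) 0 1) * ((((g⁻¹ : SL(2, ℤ)) : Matrix (Fin 2) (Fin 2) ℤ) * (((u⁻¹ : Gamma0 N) : SL(2, ℤ)) : Matrix (Fin 2) (Fin 2) ℤ) * M) 1 0 + 2 * (((g⁻¹ : SL(2, ℤ)) : Matrix (Fin 2) (Fin 2) ℤ) * (((u⁻¹ : Gamma0 N) : SL(2, ℤ)) : Matrix (Fin 2) (Fin 2) ℤ) * M) 1 1) ∨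
          (((((g⁻¹ : SL(2, ℤ)) : Matrix (Fin 2) (Fin 2) ℤ) * (((u⁻¹ : Gamma0 N) : SL(2, ℤ)) : Matrix (Fin 2) (Fin 2) ℤ) * M) 0 0 + 2 * (((g⁻¹ : SL(2, ℤ)) : Matrix (Fin 2) (Fin 2) ℤ) * (((u⁻¹ : Gamma0 N) : SL(2, ℤ)) : Matrix (Fin 2) (Fin 2) ℤ) * M) 0 1) * ((((g⁻¹ : SL(2, ℤ)) : Matrix (Fin 2) (Fin 2) ℤ) * (((u⁻¹ : Gamma0 N) : SL(2, ℤ)) : Matrix (Fin 2) (Fin 2) ℤ) * M) 1 0 + 2 * (((g⁻¹ : SL(2, ℤ)) : Matrix (Fin 2) (Fin 2) ℤ) * (((u⁻¹ : Gamma0 N) : SL(2, ℤ)) : Matrix (Fin 2) (Fin 2) ℤ) * M) 1 1) = 0 ∧ 0 < (((g⁻¹ : SL(2, ℤ)) : Matrix (Fin 2) (Fin 2) ℤ) * (((u⁻¹ : Gamma0 N) : SL(2, ℤ)) : Matrix (Fin 2) (Fin 2) ℤ) * M) 0 0 * (((g⁻¹ : SL(2, ℤ)) : Matrix (Fin 2)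 (Fin 2) ℤ) * (((u⁻¹ : Gamma0 N) : SL(2, ℤ)) : Matrix (Fin 2) (Fin 2) ℤ) * M) 1 1 + (((g⁻¹ : SL(2, ℤ)) : Matrix (Fin 2) (Fin 2) ℤ) * (((u⁻¹ : Gamma0 N) : SL(2, ℤ)) : Matrix (Fin 2) (Fin 2) ℤ) * M) 0 1 * (((g⁻¹ : SL(2, ℤ)) : Matrix (Fin 2) (Fin 2) ℤ) * (((u⁻¹ : Gamma0 N) : SL(2, ℤ)) : Matrix (Fin 2) (Fin 2) ℤ) * M) 1 0)))) then (1 : ℤ) else 0))).Finite := by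
  have hMγ : 0 < (M * ((γ : SL(2, ℤ)) : Matrix (Fin 2) (Fin 2) ℤ)).det := by
    rw [Matrix.det_mul, Matrix.SpecialLinearGroup.det_coe, mul_one]; exact hM
  obtain ⟨m₁, hm₁⟩ := exists_flagAnchor M hM
  obtain ⟨m₂, hm₂⟩ := exists_flagAnchor (M * ((γ : SL(2, ℤ)) : Matrix (Fin 2) (Fin 2) ℤ)) hMγ
  obtain ⟨A₁, hA₁⟩ := exists_dualChain m₁
  obtain ⟨A₂, hA₂⟩ := exists_dualChain m₂
  have hE : ∀ {A : Type} [AddCommGroup A] (G : SL(2, ℤ) → A), (∀ x, G (x * (S * T⁻¹)) = G x) → (∀ x, G (-x) = G x) →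
      ((((A₁.map fun h ↦ h * S) ++ [] ++ A₂.map fun h ↦ (1 : SL(2, ℤ)) * h)).map fun h ↦ G h - G (h * S)).sum = G m₂ - G m₁ := by
    intro A _ G hτ hn
    have h := dualChain_between_of_pieces m₁ m₂ 1 A₁ A₂ [] hA₁ hA₂ (fun G' _ _ ↦ by simp) G hτ hn
    rwa [one_mul] at h
  refine (finite_support_sideDiff (N := N) m₁ m₂ _ hE g).subset fun u hu ↦ ?_
  rw [Function.mem_support] at hu ⊢
  have e2 : ((((u : SL(2, ℤ)) * g)⁻¹ : SL(2, ℤ)) : Matrix (Fin 2) (Fin 2) ℤ) * (M * ((γ : SL(2, ℤ)) : Matrix (Fin 2) (Fin 2) ℤ)) = ((g⁻¹ : SL(2, ℤ)) : Matrix (Fin 2) (Fin 2) ℤ) * (((u⁻¹ : Gamma0 N) : SL(2, ℤ)) : Matrix (Fin 2) (Fin 2) ℤ) * M * ((γ : SL(2, ℤ)) : Matrix (Fin 2) (Fin 2) ℤ) := by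
    rw [mul_inv_rev, Matrix.SpecialLinearGroup.coe_mul, ← Subgroup.coe_inv]
    simp only [Matrix.mul_assoc]
  have e1 : ((((u : SL(2, ℤ)) * g)⁻¹ : SL(2, ℤ)) : Matrix (Fin 2) (Fin 2) ℤ) * M = ((g⁻¹ : SL(2, ℤ)) : Matrix (Fin 2) (Fin 2) ℤ) * (((u⁻¹ : Gamma0 N) : SL(2, ℤ)) : Matrix (Fin 2) (Fin 2) ℤ) * M := by
    rw [mul_inv_rev, Matrix.SpecialLinearGroup.coe_mul, ← Subgroup.coe_inv]
  rw [← e2, ← e1, hm₂ ((u : SL(2, ℤ)) * g), hm₁ ((u : SL(2, ℤ)) * g)] at hu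
  exact hu

end DualSupport

section Glue

variable {N : ℕ} [NeZero N]

/-- **Flipped transpose-adjointness of the crossing pairing on period functionals (brick HA8).** For `B` satisfying the crossing formula,
a prime `p`, `γ, γ' ∈ Γ₀(N)` and `x' ∈ Λ` with `x' = T♯_p^∨ {∞,γ∞}`: `B(x', {∞,γ'∞}) = B({∞,γ∞}, T_p • {∞,γ'∞})`.
[cite: Merel1995Homologie, §1.2–1.3 and §2.1–2.3] [cite: Manin1972, Thm. 1.9] [cite: DiamondShurman2005, §5.2] -/
theorem crossingPairing_flippedTransposeAdjoint_periodFunctional (B : periodHomologyHecke N →+ (periodHomologyHecke N →+ ℤ))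
    (hB : ∀ (γ γ' : Gamma0 N) (D L : List SL(2, ℤ)),
      (∀ {A : Type} [AddCommGroup A] (G : SL(2, ℤ) → A), (∀ x, G (x * (S * T⁻¹)) = G x) → (∀ x, G (-x) = G x) →
        (D.map fun h ↦ G h - G (h * S)).sum = G (γ : SL(2, ℤ)) - G 1) →
      (∀ {A : Type} [AddCommGroup A] (F : SL(2, ℤ) → A), (∀ g, F (g * T) = F g) → (∀ g, F (-g) = F g) →
        (L.map fun g ↦ F g - F (g * S)).sum = F (γ' : SL(2, ℤ)) - F 1) →
      B ⟨periodFunctional N γ, (mem_periodHomologyHecke N).mpr (periodFunctional_mem_periodHomology N γ)⟩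
        ⟨periodFunctional N γ', (mem_periodHomologyHecke N).mpr (periodFunctional_mem_periodHomology N γ')⟩ =
        (L.map fun g ↦ (D.map fun h ↦ (Pi.single ((h⁻¹ : SL(2, ℤ)) : Gamma0Coset N) (1 : ℤ) -
          Pi.single (((h * S)⁻¹ : SL(2, ℤ)) : Gamma0Coset N) 1 : Gamma0Coset N → ℤ)).sum ((g⁻¹ : SL(2, ℤ)) : Gamma0Coset N)).sum)
    (p : ℕ) (hp : p.Prime) (γ γ' : Gamma0 N) (x' : periodHomologyHecke N)
    (hx' : ((x' : periodHomologyHecke N) : Module.Dual ℂ (CuspForm (Gamma0 N) 2)) =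
        (haveI : NeZero p := ⟨hp.ne_zero⟩;
          (cuspHeckeOperatorₗ (Gamma0 N) 2 (diagGL p 1 (Nat.cast_pos.mpr (NeZero.pos p)) one_pos)).dualMap (periodFunctional N γ))) :
    B x' ⟨periodFunctional N γ', (mem_periodHomologyHecke N).mpr (periodFunctional_mem_periodHomology N γ')⟩ =
      B ⟨periodFunctional N γ, (mem_periodHomologyHecke N).mpr (periodFunctional_mem_periodHomology N γ)⟩
        (HeckeRing0.T N 2 p hp • ⟨periodFunctional N γ', (mem_periodHomologyHecke N).mpr (periodFunctional_mem_periodHomology N γ')⟩) := by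
  have hpz : (0 : ℤ) < (p : ℤ) := by exact_mod_cast hp.pos
  obtain ⟨L, hL⟩ := exists_maninChain.{0} ((γ' : Gamma0 N) : SL(2, ℤ))
  -- the per-step test function of the sweep
  obtain ⟨Φ, hΦ⟩ : ∃ Φ : SL(2, ℤ) → Matrix (Fin 2) (Fin 2) ℤ → ℤ, ∀ (g : SL(2, ℤ)) (X : Matrix (Fin 2) (Fin 2) ℤ), Φ g X =
      (if (0 < (((g⁻¹ : SL(2, ℤ)) : Matrix (Fin 2) (Fin 2) ℤ) * X * ((γ : SL(2, ℤ)) : Matrix (Fin 2) (Fin 2) ℤ)) 0 0 * (((g⁻¹ : SL(2, ℤ)) : Matrix (Fin 2) (Fin 2) ℤ) * X * ((γ : SL(2, ℤ)) : Matrix (Fin 2) (Fin 2) ℤ)) 1 0 ∨ ((((g⁻¹ : SL(2, ℤ)) : Matrix (Fin 2) (Fin 2) ℤ) * X * ((γ : SL(2, ℤ)) : Matrix (Fin 2) (Fin 2) ℤ)) 0 0 * (((g⁻¹ : SL(2, ℤ)) : Matrix (Fin 2) (Fin 2) ℤ) * X * ((γ : SL(2, ℤ)) : Matrix (Fin 2)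 (Fin 2) ℤ)) 1 0 = 0 ∧ (0 < ((((g⁻¹ : SL(2, ℤ)) : Matrix (Fin 2) (Fin 2) ℤ) * X * ((γ : SL(2, ℤ)) : Matrix (Fin 2) (Fin 2) ℤ)) 0 0 + 2 * (((g⁻¹ : SL(2, ℤ)) : Matrix (Fin 2) (Fin 2) ℤ) * X * ((γ : SL(2, ℤ)) : Matrix (Fin 2) (Fin 2) ℤ)) 0 1) * ((((g⁻¹ : SL(2, ℤ)) : Matrix (Fin 2) (Fin 2) ℤ) * X * ((γ : SL(2, ℤ)) : Matrix (Fin 2) (Fin 2) ℤ)) 1 0 + 2 * (((g⁻¹ : SL(2, ℤ)) : Matrix (Fin 2) (Fin 2) ℤ) * X * ((γ : SL(2, ℤ)) : Matrix (Fin 2) (Fin 2) ℤ)) 1 1) ∨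
          (((((g⁻¹ : SL(2, ℤ)) : Matrix (Fin 2) (Fin 2) ℤ) * X * ((γ : SL(2, ℤ)) : Matrix (Fin 2) (Fin 2) ℤ)) 0 0 + 2 * (((g⁻¹ : SL(2, ℤ)) : Matrix (Fin 2) (Fin 2) ℤ) * X * ((γ : SL(2, ℤ)) : Matrix (Fin 2) (Fin 2) ℤ)) 0 1) * ((((g⁻¹ : SL(2, ℤ)) : Matrix (Fin 2) (Fin 2) ℤ) * X * ((γ : SL(2, ℤ)) : Matrix (Fin 2) (Fin 2) ℤ)) 1 0 + 2 * (((g⁻¹ : SL(2, ℤ)) : Matrix (Fin 2) (Fin 2) ℤ) * X * ((γ : SL(2, ℤ)) : Matrix (Fin 2) (Fin 2) ℤ)) 1 1) = 0 ∧ 0 < (((g⁻¹ : SL(2, ℤ)) : Matrix (Fin 2) (Fin 2) ℤ) * X * ((γ : SL(2, ℤ)) : Matrix (Fin 2) (Fin 2) ℤ)) 0 0 * (((g⁻¹ : SL(2, ℤ)) : Matrix (Fin 2) (Fin 2) ℤ) * X * ((γ : SL(2, ℤ)) : Matrix (Fin 2) (Fin 2) ℤ)) 1 1 + (((g⁻¹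 : SL(2, ℤ)) : Matrix (Fin 2) (Fin 2) ℤ) * X * ((γ : SL(2, ℤ)) : Matrix (Fin 2) (Fin 2) ℤ)) 0 1 * (((g⁻¹ : SL(2, ℤ)) : Matrix (Fin 2) (Fin 2) ℤ) * X * ((γ : SL(2, ℤ)) : Matrix (Fin 2) (Fin 2) ℤ)) 1 0)))) then (1 : ℤ) else 0) -
      (if (0 < (((g⁻¹ : SL(2, ℤ)) : Matrix (Fin 2) (Fin 2) ℤ) * X) 0 0 * (((g⁻¹ : SL(2, ℤ)) : Matrix (Fin 2) (Fin 2) ℤ) * X) 1 0 ∨ ((((g⁻¹ : SL(2, ℤ)) : Matrix (Fin 2) (Fin 2) ℤ) * X) 0 0 * (((g⁻¹ : SL(2, ℤ)) : Matrix (Fin 2) (Fin 2) ℤ) * X) 1 0 = 0 ∧ (0 < ((((g⁻¹ : SL(2, ℤ)) : Matrix (Fin 2) (Fin 2) ℤ) * X) 0 0 + 2 * (((g⁻¹ : SL(2, ℤ)) : Matrix (Fin 2) (Fin 2) ℤ) * X) 0 1) * ((((g⁻¹ : SL(2, ℤ)) : Matrix (Fin 2) (Fin 2) ℤ) * X) 1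 0 + 2 * (((g⁻¹ : SL(2, ℤ)) : Matrix (Fin 2) (Fin 2) ℤ) * X) 1 1) ∨
          (((((g⁻¹ : SL(2, ℤ)) : Matrix (Fin 2) (Fin 2) ℤ) * X) 0 0 + 2 * (((g⁻¹ : SL(2, ℤ)) : Matrix (Fin 2) (Fin 2) ℤ) * X) 0 1) * ((((g⁻¹ : SL(2, ℤ)) : Matrix (Fin 2) (Fin 2) ℤ) * X) 1 0 + 2 * (((g⁻¹ : SL(2, ℤ)) : Matrix (Fin 2) (Fin 2) ℤ) * X) 1 1) = 0 ∧ 0 < (((g⁻¹ : SL(2, ℤ)) : Matrix (Fin 2) (Fin 2) ℤ) * X) 0 0 * (((g⁻¹ : SL(2, ℤ)) : Matrix (Fin 2) (Fin 2) ℤ) * X) 1 1 + (((g⁻¹ : SL(2, ℤ)) : Matrix (Fin 2) (Fin 2) ℤ) * X) 0 1 * (((g⁻¹ : SL(2, ℤ)) : Matrix (Fin 2) (Fin 2) ℤ) * X) 1 0)))) then (1 : ℤ) else 0) := ⟨_, fun _ _ ↦ rfl⟩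
  have ea : ∀ (g : SL(2, ℤ)) (X Y : Matrix (Fin 2) (Fin 2) ℤ), ((g⁻¹ : SL(2, ℤ)) : Matrix (Fin 2) (Fin 2) ℤ) * (X * Y) = ((g⁻¹ : SL(2, ℤ)) : Matrix (Fin 2) (Fin 2) ℤ) * X * Y := fun g X Y ↦ (Matrix.mul_assoc _ _ _).symm
  -- finiteness inputs of the sweep, in `Φ`-form
  have hfinM : ∀ (g : SL(2, ℤ)) (X : Matrix (Fin 2) (Fin 2) ℤ), 0 < X.det →
      (Function.support fun u : Gamma0 N ↦ Φ g (X.adjugate * (((u⁻¹ : Gamma0 N) : SL(2, ℤ)) : Matrix (Fin 2) (Fin 2) ℤ))).Finite := by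
    intro g X hX
    simp only [hΦ, ea]
    exact finite_support_manin_summand γ X hX g
  have hfinD : ∀ (g : SL(2, ℤ)) (X : Matrix (Fin 2) (Fin 2) ℤ), 0 < X.det →
      (Function.support fun u : Gamma0 N ↦ Φ g ((((u⁻¹ : Gamma0 N) : SL(2, ℤ)) : Matrix (Fin 2) (Fin 2) ℤ) * X)).Finite := by
    intro g X hX
    simp only [hΦ, ea]
    exact finite_support_dual_summand γ X hX g
  apply mul_left_cancel₀ (two_ne_zero : (2 : ℤ) ≠ 0)
  by_cases hpN : p ∣ N
  · -- `p ∣ N`: index `Fin p`, Manin reps `(1 j; 0 p)`, dual reps `(p 0; -Nj 1)`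
    obtain ⟨σ, δ, hcoc⟩ := exists_heckeCocycle_fin N hp hpN γ'
    have hT := heckeT_smul_periodFunctional_eq_sum_cocycle_fin N hp hpN γ' σ δ hcoc
    obtain ⟨σ', ε, hcoc', hsum'⟩ := exists_transposeHeckeCocycle_fin N hp hpN γ
    have hx'eq : x' = ∑ j : Fin p, (⟨periodFunctional N (ε j), periodFunctional_mem_periodHomology N (ε j)⟩ : periodHomologyHecke N) :=
      Subtype.ext (hx'.trans hsum'.symm)
    have hdetM : ∀ j : Fin p, 0 < (!![(1 : ℤ), ((j : ℕ) : ℤ); 0, (p : ℤ)] : Matrix (Fin 2) (Fin 2) ℤ).det := by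
      intro j; rw [Matrix.det_fin_two_of]; linarith
    have hupM : ∀ j : Fin p, (!![(1 : ℤ), ((j : ℕ) : ℤ); 0, (p : ℤ)] : Matrix (Fin 2) (Fin 2) ℤ) 1 0 = 0 := fun j ↦ rfl
    have hdetD : ∀ j : Fin p, 0 < (!![(p : ℤ), 0; -((N : ℤ) * ((j : ℕ) : ℤ)), 1] : Matrix (Fin 2) (Fin 2) ℤ).det := by
      intro j; rw [Matrix.det_fin_two_of]; linarith
    have hMside := manin_side_flag_sum B hB γ γ' L hL (fun j : Fin p ↦ (!![(1 : ℤ), ((j : ℕ) : ℤ); 0, (p : ℤ)] : Matrix (Fin 2) (Fin 2) ℤ))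
      hdetM hupM δ σ hcoc
    have hDside := dual_side_flag_sum B hB γ γ' L hL (fun j : Fin p ↦ (!![(p : ℤ), 0; -((N : ℤ) * ((j : ℕ) : ℤ)), 1] : Matrix (Fin 2) (Fin 2) ℤ))
      hdetD ε σ' hcoc'
    rw [hx'eq, hT, map_sum B, AddMonoidHom.finsetSum_apply, map_sum (B _), hDside, hMside]
    refine congrArg List.sum (List.map_congr_left fun g _ ↦ ?_)
    have key := sum_finsum_adj_tpB_mul_inv_eq (N := N) (A := ℤ) hp hpN (Φ g) (fun j ↦ hfinM g _ (hdetM j)) (fun j ↦ hfinD g _ (hdetD j))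
    refine (Finset.sum_congr rfl fun j _ ↦ finsum_congr fun u ↦ ?_).trans
      (key.symm.trans (Finset.sum_congr rfl fun j _ ↦ finsum_congr fun u ↦ ?_))
    · rw [hΦ, ea]
    · rw [hΦ, ea]
  · -- `p ∤ N`: index `Option (Fin p)`, Manin reps `diag(p,1)`, `(1 j; 0 p)`, dual reps `diag(1,p)`, `(p 0; -Nj 1)`
    obtain ⟨σ, δ, hcoc⟩ := exists_heckeCocycle_option N hp hpN γ'
    have hT := heckeT_smul_periodFunctional_eq_sum_cocycle_option N hp hpN γ' σ δ hcoc
    obtain ⟨σ', ε, hcoc', hsum'⟩ := exists_transposeHeckeCocycle_option N hp hpN γ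
    have hx'eq : x' = ∑ i : Option (Fin p),
        (⟨periodFunctional N (ε i), periodFunctional_mem_periodHomology N (ε i)⟩ : periodHomologyHecke N) :=
      Subtype.ext (hx'.trans hsum'.symm)
    have hdetM : ∀ i : Option (Fin p),
        0 < ((i.elim !![(p : ℤ), 0; 0, 1] fun j ↦ !![(1 : ℤ), ((j : ℕ) : ℤ); 0, (p : ℤ)]) : Matrix (Fin 2) (Fin 2) ℤ).det := by
      rintro (_ | j) <;> dsimp only [Option.elim] <;> rw [Matrix.det_fin_two_of] <;> linarith
    have hupM : ∀ i : Option (Fin p), ((i.elim !![(p : ℤ), 0; 0, 1] fun j ↦ !![(1 : ℤ), ((j : ℕ) : ℤ); 0, (p : ℤ)]) : Matrix (Fin 2) (Fin 2) ℤ) 1 0 = 0 := by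
      rintro (_ | j) <;> rfl
    have hdetD : ∀ i : Option (Fin p),
        0 < ((i.elim !![(1 : ℤ), 0; 0, (p : ℤ)] fun j ↦ !![(p : ℤ), 0; -((N : ℤ) * ((j : ℕ) : ℤ)), 1]) : Matrix (Fin 2) (Fin 2) ℤ).det := by
      rintro (_ | j) <;> dsimp only [Option.elim] <;> rw [Matrix.det_fin_two_of] <;> linarith
    have hMside := manin_side_flag_sum B hB γ γ' L hL
      (fun i : Option (Fin p) ↦ ((i.elim !![(p : ℤ), 0; 0, 1] fun j ↦ !![(1 : ℤ), ((j : ℕ) : ℤ); 0, (p : ℤ)]) : Matrix (Fin 2) (Fin 2) ℤ)) hdetM hupM δ σ hcoc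
    have hDside := dual_side_flag_sum B hB γ γ' L hL
      (fun i : Option (Fin p) ↦ ((i.elim !![(1 : ℤ), 0; 0, (p : ℤ)] fun j ↦ !![(p : ℤ), 0; -((N : ℤ) * ((j : ℕ) : ℤ)), 1]) : Matrix (Fin 2) (Fin 2) ℤ))
      hdetD ε σ' hcoc'
    rw [hx'eq, hT, map_sum B, AddMonoidHom.finsetSum_apply, map_sum (B _), hDside, hMside]
    refine congrArg List.sum (List.map_congr_left fun g _ ↦ ?_)
    have key := sum_finsum_adj_rep_mul_inv_eq (N := N) (A := ℤ) hp hpN (Φ g) (fun i ↦ hfinM g _ (hdetM i)) (fun i ↦ hfinD g _ (hdetD i))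
    refine (Finset.sum_congr rfl fun i _ ↦ finsum_congr fun u ↦ ?_).trans
      (key.symm.trans (Finset.sum_congr rfl fun i _ ↦ finsum_congr fun u ↦ ?_))
    · rw [hΦ, ea]
    · rw [hΦ, ea]

/-- **Brick HA8 in the exact shape of the hypothesis `hHA` of `ip_of_crossingPairing_flippedTransposeAdjoint`**: for every level, every
pairing satisfying the crossing formula, every prime `p` and `x, y, x' ∈ Λ` with `x' = T♯_p^∨ x`: `B(x', y) = B(x, T_p • y)` (period functionals
exhaust `Λ`, `coe_periodHomology_eq_range`). [cite: Merel1995Homologie, §1.2–1.3 and §2.1–2.3] [cite: Manin1972, Thm. 1.9] -/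
theorem crossingPairing_flippedTransposeAdjoint (N : ℕ) [NeZero N] (B : periodHomologyHecke N →+ (periodHomologyHecke N →+ ℤ))
    (hB : ∀ (γ γ' : Gamma0 N) (D L : List SL(2, ℤ)),
      (∀ {A : Type} [AddCommGroup A] (G : SL(2, ℤ) → A), (∀ x, G (x * (S * T⁻¹)) = G x) → (∀ x, G (-x) = G x) →
        (D.map fun h ↦ G h - G (h * S)).sum = G (γ : SL(2, ℤ)) - G 1) →
      (∀ {A : Type} [AddCommGroup A] (F : SL(2, ℤ) → A), (∀ g, F (g * T) = F g) → (∀ g, F (-g) = F g) →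
        (L.map fun g ↦ F g - F (g * S)).sum = F (γ' : SL(2, ℤ)) - F 1) →
      B ⟨periodFunctional N γ, (mem_periodHomologyHecke N).mpr (periodFunctional_mem_periodHomology N γ)⟩
        ⟨periodFunctional N γ', (mem_periodHomologyHecke N).mpr (periodFunctional_mem_periodHomology N γ')⟩ =
        (L.map fun g ↦ (D.map fun h ↦ (Pi.single ((h⁻¹ : SL(2, ℤ)) : Gamma0Coset N) (1 : ℤ) -
          Pi.single (((h * S)⁻¹ : SL(2, ℤ)) : Gamma0Coset N) 1 : Gamma0Coset N → ℤ)).sum ((g⁻¹ : SL(2, ℤ)) : Gamma0Coset N)).sum)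
    (p : ℕ) (hp : p.Prime) (x y x' : periodHomologyHecke N)
    (hx' : ((x' : periodHomologyHecke N) : Module.Dual ℂ (CuspForm (Gamma0 N) 2)) =
        (haveI : NeZero p := ⟨hp.ne_zero⟩;
          (cuspHeckeOperatorₗ (Gamma0 N) 2 (diagGL p 1 (Nat.cast_pos.mpr (NeZero.pos p)) one_pos)).dualMap
            (x : Module.Dual ℂ (CuspForm (Gamma0 N) 2)))) :
    B x' y = B x (HeckeRing0.T N 2 p hp • y) := by
  have hx : (x : Module.Dual ℂ (CuspForm (Gamma0 N) 2)) ∈ (periodHomology N : Set (Module.Dual ℂ (CuspForm (Gamma0 N) 2))) :=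
    (mem_periodHomologyHecke N).mp x.2
  have hy : (y : Module.Dual ℂ (CuspForm (Gamma0 N) 2)) ∈ (periodHomology N : Set (Module.Dual ℂ (CuspForm (Gamma0 N) 2))) :=
    (mem_periodHomologyHecke N).mp y.2
  rw [coe_periodHomology_eq_range] at hx hy
  obtain ⟨γ, hγ⟩ := hx
  obtain ⟨γ', hγ'⟩ := hy
  have ex : x = ⟨periodFunctional N γ, (mem_periodHomologyHecke N).mpr (periodFunctional_mem_periodHomology N γ)⟩ := Subtype.ext hγ.symm
  have ey : y = ⟨periodFunctional N γ', (mem_periodHomologyHecke N).mpr (periodFunctional_mem_periodHomology N γ')⟩ := Subtype.ext hγ'.symm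
  subst ex ey
  exact crossingPairing_flippedTransposeAdjoint_periodFunctional B hB p hp γ γ' x' hx'

/-- **IP from the crossing pairing (Hecke clause of the SD floor, by name).** The named input
`periodHomology_exists_heckeSelfAdjoint_perfectPairing` — a perfect Hecke-self-adjoint pairing on `Λ = periodHomologyHecke N` for every
`N ≥ 1` — follows from `ip_of_crossingPairing_flippedTransposeAdjoint` and brick HA8. Kan⁺ is NOT settled by this; BSD is not proved by this.
[cite: Merel1995Homologie, §1.2–1.3 and §2.1–2.3] [cite: Manin1972, Thm. 1.9] -/
theorem ip_of_crossingPairing_flagSides : periodHomology_exists_heckeSelfAdjoint_perfectPairing :=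
  ip_of_crossingPairing_flippedTransposeAdjoint fun N _ B hB p hp x y x' hx' ↦
    crossingPairing_flippedTransposeAdjoint N B hB p hp x y x' hx'

end Glue

end Summit.BirchSwinnertonDyer.BirchSwinnertonDyer.Theorems.ThetaLayerLambdaCongruenceAtTwo

end
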